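import Summits.Schanuel.Schanuel.Theorems.RootDecomp1BProductCell01

/-!
# RootDecomp1BProductCell — lens 4, generation 46 «PRODUCT CELL: TWO INDEPENDENT LIOUVILLE COORDINATES VIA THE QUANTITATIVE STOREY-ONE CELL» (CLAIM L2339, PRICE + CHECKLIST B-g46 L2340, NODE L2399 / REQUEST L2400, critic VERDICT L2407: CLEARED — THEOREM ×1 (K1 twoRadical_lower, the composable quantitative engine) + ONE CELL «RATE-MATCHED PRODUCT 𝒜_W × ℬ_W» (K2 algebraicIndependent_product + cells); RULE B-R33; PORT GO) — continuation (RootDecomp1BProductCell02): §3 the quantitative kernel K1 twoRadical_lower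

(lens-4 g46 HOME kernel K = HOME/decomp-schanuel-lens-4/g46/ProductCell.lean d6cd9943…, 1931 l, ONE import …RootDecomp1BTwoRadical05; P/C + NODE-g46.md 601195d2…. Port by census-1 gen 20 as `RootDecomp1BProductCell01–08` from the census CAP EDITION ProductCell.capped.lean (K2 `algebraicIndependent_product` is ONE 398-line declaration block > the 400-line file cap: its step (3) «thrP(N) ≤ exp(c_T q⁴)» — four exponential bounds, context-free — is extracted as the public lemma `thr_le_exp_quartic` in §3c with the local abbreviations passed as variables and the defining equation of c_T as a hypothesis; K2's STATEMENT byte-identical, all 87 K decl signatures identical, +1 decl; farm rc 0 · 0/0/0 · axioms std on K2): 01 = §1 Lipschitz (`FrelC`, `lam`, `lipschitz_Frel₂_explicit`) + §2 root avoidance (`fibreSum_ne_zero`); 02 = §3 K1 `thr`, `bigTheta`, `thrP`, **`twoRadical_lower`**; 03 = §3b outer upper half (`norm_normForm_le`, `normForm_len_le`); 04 = §3c `thr_le`, `thr_le_exp_quartic` (cap lemma) + §4 classes `UltraLiouvilleSW` / `TowerLiouville` («[class] definition» tags) + `thr_nonneg` + §5 prelude `thetaS`; 05 = §5 K2 **`algebraicIndependent_product`**;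 06 = §6 law `sw`, members `ultraLiouvilleSW_rhoU` (tree rhoU), `gT`/`vT`/`tTerm`/`rhoT`/`tNum`/`tRat`, `towerLiouville_rhoT`; 07 = §7 cells `algebraicIndependent_eight_of_pos`, `eight_le_polarDeg_one_pair`, `six_le_polarDeg_one_pair`, `schanuel_body_one_pair`, `six_le_polarDeg_pair`, `four_le_polarDeg_pair`, `schanuel_body_pair`, named pair (ρ_U, ρ_T) hyp-free; 08 = §8 `E₅`, `thrP_le_exp`, `transcMeasure_thetaS`, `transcMeasure_rhoU`. PORT EDITS (VERDICT L2407 (a)–(d) + the cap edition): linter option dropped; 26 one-line docstrings added; class tags in the census wording; scoped heartbeats kept `… in` (1600000 ×2, 800000 ×1 as in K); per-part private helper copies; statements and proofs otherwise verbatim (no renames). `--supports stmt-Schanuel-24622`; no census credit carried; rung 0 — nothing here proves Schanuel; no ∀-item moves.)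
-/

noncomputable section
open Complex
namespace Summit.Schanuel.Schanuel.Theorems.RootDecomp1BProductCell
open MvPolynomial
open Summit.Schanuel.Schanuel.Theorems.RootDecomp1KHyper (mvlen mvlen_nonneg one_le_mvlen abs_coeff_le_mvlen)
open RootDecomp1BRadicalDescent (resFin DExpMeasure UltraLiouville exists_int_relation norm_mvaeval_le_mvlen
  totalDegree_det_le mvlen_det_le adjugate_bounds)
open RootDecomp1BTwoRadical (sX₃ sX₃_apply eq_of_parts₃ Cf₂ Frel₂ Frel₂_eq_aeval radMat₂ det_radMat₂_ne_zero
  det_eq_eigen_mul₂ eigen_eq_Frel₂ mvlen_radMat₂_le totalDegree_radMat₂_le mvlen_Cf₂_le twoRadical_clash)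
variable {n : ℕ}

/-! ## §3 THE QUANTITATIVE KERNEL: a lower bound at every admissible scale -/

section Quantitative

/-- **The explicit scale threshold** `thr = c₃ + 3 + a` of the two-radical descent, as a closed formula in the
measure exponent `A₀`, the size constants `Θ` (base point), `Λ` (Lipschitz base), `B = ⌈σ⌉ + 1`, the degree `D` and
the length `L` of the relation (g44b's `c₃ = (Kl + 1) + cU + cN`, `a = A (δe+1)^A` with `K = J = D`,
`Kl = L·Λ^D + 1`, `δe = D + 2BD`, `cE = 2(D+1) + L + D(B+1)`, `cN = cE + 2`, `cU = (D+2) + cE + Θ(δe+2)`). -/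
def thr (A₀ : ℕ) (Θ Λ : ℝ) (B D : ℕ) (L : ℤ) : ℝ :=
  ((((L : ℝ) * Λ ^ D + 1) + 1)
      + ((((D : ℝ) + 2) + (2 * ((D : ℝ) + 1) + L + D * ((B : ℝ) + 1))) + Θ * (((D + 2 * (B * D) : ℕ) : ℝ) + 2))
      + ((2 * ((D : ℝ) + 1) + L + D * ((B : ℝ) + 1)) + 2))
    + 3 + ((A₀ + 1 : ℕ) : ℝ) * (((D + 2 * (B * D) : ℕ) : ℝ) + 1) ^ (A₀ + 1)

/-- the size constant of a base point: `Θ(θ) = 1 + Σ ‖θ_i‖` -/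
def bigTheta (θ : Fin n → ℂ) : ℝ := 1 + ∑ i, ‖θ i‖

/-- `1 ≤ Θ(θ)`. -/
theorem one_le_bigTheta (θ : Fin n → ℂ) : 1 ≤ bigTheta θ := by
  unfold bigTheta; linarith [Finset.sum_nonneg fun i (_ : i ∈ Finset.univ) => norm_nonneg (θ i)]

/-- Every coordinate is bounded by `Θ(θ)`. -/
theorem norm_le_bigTheta (θ : Fin n → ℂ) (i : Fin n) : ‖θ i‖ ≤ bigTheta θ := by
  have := Finset.single_le_sum (fun j (_ : j ∈ Finset.univ) => norm_nonneg (θ j)) (Finset.mem_univ i)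
  unfold bigTheta; linarith

/-- **The threshold of a relation `P` at the data `(θ, y₀, y₁, σ, A₀)`.** -/
def thrP (A₀ : ℕ) (θ : Fin n → ℂ) (y₀ y₁ : ℂ) (σ : ℝ) (P : MvPolynomial (Fin (n + 3)) ℤ) : ℝ :=
  thr A₀ (bigTheta θ) (lam (bigTheta θ) y₀ y₁ (|σ| + 2)) (⌈σ⌉₊ + 1) P.totalDegree (mvlen P)

set_option maxHeartbeats 1600000 in
/-- **QUANTITATIVE KERNEL (two-radical descent with a lower bound).** Let `θ ∈ ℂⁿ` satisfy the degree-uniform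
measure with exponent `A₀`, `e^{y₀} = θ_{i₀}`, `e^{y₁} = θ_{i₁}` (`i₀ ≠ i₁`), `σ > 0`. For EVERY nonzero
`P ∈ ℤ[U, V, Y, X]` and EVERY rational `r` with `den r ≥ thrP` (explicit), `|σ − r| < min(σ, 1)` and
`|σ − r| < exp(−exp((den r)^{2(A₀+2)}))`:
`‖P(e^{σ y₀}, e^{σ y₁}, σ, θ)‖ ≥ exp(−exp(((den r)²)^{A₀+2}))`.
Proof = g44b's kernel with the exact zero replaced by a small value (folded into the Lipschitz term), the
existential Lipschitz constant replaced by §1 and the punctured ball by §2; steps (2)–(5) are the tree's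
`twoRadical_clash` verbatim (at `Q₁ := q`). -/
theorem twoRadical_lower {θ : Fin n → ℂ} {A₀ : ℕ}
    (hA₀ : ∀ Q : MvPolynomial (Fin n) ℤ, Q ≠ 0 →
      Real.exp (-((Real.log (mvlen Q : ℝ) + 1) * Real.exp ((A₀ : ℝ) * ((Q.totalDegree : ℝ) + 1) ^ A₀))) ≤
        ‖MvPolynomial.aeval θ Q‖)
    {i₀ i₁ : Fin n} (hne : i₀ ≠ i₁) {y₀ y₁ : ℂ} (hy₀ : cexp y₀ = θ i₀) (hy₁ : cexp y₁ = θ i₁)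
    {σ : ℝ} (hσ0 : 0 < σ) (P : MvPolynomial (Fin (n + 3)) ℤ) (hP0 : P ≠ 0) (r : ℚ)
    (hden : thrP A₀ θ y₀ y₁ σ P ≤ r.den) (hrσ : |σ - r| < σ) (hr1 : |σ - r| < 1)
    (hrate : |σ - r| < Real.exp (-Real.exp ((r.den : ℝ) ^ (2 * (A₀ + 2))))) :
    Real.exp (-Real.exp ((((r.den : ℕ) : ℝ) ^ 2) ^ (A₀ + 2))) ≤ ‖Frel₂ P θ y₀ y₁ σ‖ := by
  classical
  by_contra hsmallF
  push Not at hsmallF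
  -- degrees: K = J = D
  set D := P.totalDegree with hD
  have hK : ∀ s ∈ P.support, s 0 ≤ D ∧ s 1 ≤ D := fun s hs =>
    ⟨(monomial_le_degreeOf 0 hs).trans (degreeOf_le_totalDegree P 0),
      (monomial_le_degreeOf 1 hs).trans (degreeOf_le_totalDegree P 1)⟩
  have hJ : ∀ s ∈ P.support, s 2 ≤ D := fun s hs => (monomial_le_degreeOf 2 hs).trans (degreeOf_le_totalDegree P 2)
  -- a monomial s₀ of P and its fibre
  obtain ⟨s₀, hs₀⟩ : ∃ s₀, s₀ ∈ P.support := by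
    obtain ⟨t, ht⟩ := MvPolynomial.ne_zero_iff.mp hP0
    exact ⟨t, mem_support_iff.mpr ht⟩
  set kk₀ : ℕ × ℕ := (s₀ 0, s₀ 1) with hkk₀
  set m₀ : Fin n →₀ ℕ := sX₃ s₀ with hm₀
  -- q-independent sizes
  set Θ : ℝ := bigTheta θ with hΘ
  have hΘ1 : 1 ≤ Θ := one_le_bigTheta θ
  have hθΘ : ∀ i, ‖θ i‖ ≤ Θ := norm_le_bigTheta θ
  set Λ : ℝ := lam Θ y₀ y₁ (|σ| + 2) with hΛ
  have hΛ1 : 1 ≤ Λ := one_le_lam hΘ1 y₀ y₁ (by positivity)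
  set Bρ : ℕ := ⌈σ⌉₊ + 1 with hBρ
  have hBρ1 : σ + 1 ≤ Bρ := by rw [hBρ]; push_cast; linarith [Nat.le_ceil σ]
  set δe : ℕ := D + 2 * (Bρ * D) with hδe
  set LP : ℤ := mvlen P with hLP
  have hLP1 : 1 ≤ LP := one_le_mvlen hP0
  have hLP1r : (1 : ℝ) ≤ LP := by exact_mod_cast hLP1
  set Klx : ℝ := (LP : ℝ) * Λ ^ D with hKlx
  have hKlx0 : 0 ≤ Klx := by rw [hKlx]; positivity
  set Kl : ℝ := Klx + 1 with hKl
  have hKl0 : 0 ≤ Kl := by rw [hKl]; positivity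
  set A : ℕ := A₀ + 1 with hA
  set a : ℝ := A * ((δe : ℝ) + 1) ^ A with ha
  set cE : ℝ := 2 * ((D : ℝ) + 1) + LP + D * ((Bρ : ℝ) + 1) with hcE
  set cN : ℝ := cE + 2 with hcN
  set cU : ℝ := ((D : ℝ) + 2) + cE + Θ * ((δe : ℝ) + 2) with hcU
  set c₃ : ℝ := (Kl + 1) + cU + cN with hc₃
  have hthr : thrP A₀ θ y₀ y₁ σ P = c₃ + 3 + a := rfl
  -- the small quantity X
  set X : ℝ := Real.exp (-Real.exp ((((r.den : ℕ) : ℝ) ^ 2) ^ (A₀ + 2))) with hX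
  have hX0 : 0 ≤ X := (Real.exp_pos _).le
  have hrX : |(r : ℝ) - σ| ≤ X := by
    rw [abs_sub_comm, hX, ← pow_mul]
    exact hrate.le
  -- the scale q = den r
  set q : ℕ := r.den with hqdef
  have hq : 0 < q := r.pos
  have hq1r : (1 : ℝ) ≤ q := by exact_mod_cast hq
  have hq0r : (0 : ℝ) < q := by positivity
  have hcE0 : 0 ≤ cE := by rw [hcE]; positivity
  have hcU0 : 0 ≤ cU := by rw [hcU]; positivity
  have ha0 : 0 ≤ a := by rw [ha]; positivity
  have hthrq : c₃ + 3 + a ≤ q := by rw [← hthr]; exact hden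
  have hQ₁ : c₃ + 2 + a < q := by linarith
  have hqK2 : D + 2 ≤ q := by
    have h1 : (D : ℝ) + 2 ≤ c₃ + 3 + a := by
      rw [hc₃, hcU]; nlinarith [hcE0, hKl0, ha0, mul_nonneg (by linarith : (0:ℝ) ≤ Θ) (by positivity : (0:ℝ) ≤ (δe : ℝ) + 2), show (0:ℝ) ≤ cN by rw [hcN]; positivity]
    exact_mod_cast h1.trans hthrq
  have hKq : D < q := by omega
  have hLPq : LP < (q : ℤ) := by
    have h1 : (LP : ℝ) + 1 ≤ c₃ + 3 + a := by
      rw [hc₃, hcN, hcE]; nlinarith [hcU0, hKl0, ha0, show (0:ℝ) ≤ (D:ℝ) * ((Bρ : ℝ) + 1) by positivity]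
    have h2 : (LP : ℝ) < q := by linarith
    exact_mod_cast h2
  have hqqN : q ≤ q * q := Nat.le_mul_self q
  -- r > 0, r = p/q in lowest terms
  have hr0 : (0 : ℝ) < r := by have := abs_lt.1 hrσ; linarith
  have hr0' : (0 : ℚ) < r := by exact_mod_cast hr0
  set p : ℕ := r.num.natAbs with hpdef
  have hpnum : (p : ℤ) = r.num := Int.natAbs_of_nonneg (Rat.num_pos.2 hr0').le
  have hpq : Nat.Coprime p q := r.reduced
  have hr_eq : (r : ℝ) = (p : ℝ) / q := by
    rw [Rat.cast_def, hqdef]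
    congr 1
    rw [← hpnum]; push_cast; rfl
  have hr_eqC : ((r : ℚ) : ℂ) = (p : ℂ) / (q : ℂ) := by
    rw [← Complex.ofReal_ratCast, hr_eq]; push_cast; rfl
  have hρr1 : |(r : ℝ) - σ| < 1 := by rw [abs_sub_comm]; exact hr1
  have hpB : p ≤ Bρ * q := by
    have h1 : (r : ℝ) < σ + 1 := by have := abs_lt.1 hr1; linarith
    have h2 : (p : ℝ) / q < Bρ := by rw [← hr_eq]; linarith
    have h3 : (p : ℝ) < Bρ * q := by rwa [div_lt_iff₀ hq0r] at h2
    exact_mod_cast h3.le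
  -- the radicals s = e^{y₀/q}, s' = e^{y₁/q}
  obtain ⟨s, hsdef⟩ : ∃ s : ℂ, s = cexp (y₀ / q) := ⟨_, rfl⟩
  obtain ⟨s', hs'def⟩ : ∃ s' : ℂ, s' = cexp (y₁ / q) := ⟨_, rfl⟩
  have hqC : (q : ℂ) ≠ 0 := by exact_mod_cast hq.ne'
  have hsq : s ^ q = θ i₀ := by
    rw [hsdef, ← Complex.exp_nat_mul, mul_div_cancel₀ _ hqC, hy₀]
  have hs'q : s' ^ q = θ i₁ := by
    rw [hs'def, ← Complex.exp_nat_mul, mul_div_cancel₀ _ hqC, hy₁]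
  have hsp : s ^ p = cexp (((((p : ℝ) / q : ℝ)) : ℂ) * y₀) := by
    rw [hsdef, ← Complex.exp_nat_mul]
    congr 1
    push_cast
    field_simp
  have hs'p : s' ^ p = cexp (((((p : ℝ) / q : ℝ)) : ℂ) * y₁) := by
    rw [hs'def, ← Complex.exp_nat_mul]
    congr 1
    push_cast
    field_simp
  have hrootΘ : ∀ {z : ℂ} {i : Fin n}, z ^ q = θ i → ‖z‖ ≤ Θ := by
    intro z i hz
    by_contra h
    push Not at h
    have h1 : 1 ≤ ‖z‖ := hΘ1.trans h.le
    have h2 : ‖z‖ ≤ ‖z‖ ^ q := le_self_pow₀ h1 (by omega)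
    have h3 : ‖z‖ ^ q = ‖θ i‖ := by rw [← norm_pow, hz]
    linarith [hθΘ i]
  have hsΘ : ‖s‖ ≤ Θ := hrootΘ hsq
  have hs'Θ : ‖s'‖ ≤ Θ := hrootΘ hs'q
  -- some C_{kk'} is nonzero: C_{kk₀} has the coefficient q^D · (fibre sum at r) ≠ 0 at m₀ (ROOT AVOIDANCE, §2)
  have hC : ∃ kk ∈ Finset.range (D + 1) ×ˢ Finset.range (D + 1), Cf₂ P p q D kk ≠ 0 := by
    refine ⟨kk₀, Finset.mem_product.2 ⟨Finset.mem_range.2 (Nat.lt_succ_of_le (hK s₀ hs₀).1),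
      Finset.mem_range.2 (Nat.lt_succ_of_le (hK s₀ hs₀).2)⟩, fun h0 => ?_⟩
    have hcoef : (Cf₂ P p q D kk₀).coeff m₀ =
        ∑ s ∈ P.support with ((s 0, s 1) = kk₀ ∧ sX₃ s = m₀),
          P.coeff s * (p : ℤ) ^ (s 2) * (q : ℤ) ^ (D - s 2) := by
      rw [Cf₂, coeff_sum]
      simp only [coeff_monomial]
      rw [Finset.sum_filter, Finset.sum_filter]
      refine Finset.sum_congr rfl fun s _ => ?_
      by_cases h1 : (s 0, s 1) = kk₀ <;> by_cases h2 : sX₃ s = m₀ <;> simp [h1, h2]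
    have hcast : (((Cf₂ P p q D kk₀).coeff m₀ : ℤ) : ℂ) =
        (q : ℂ) ^ D * ∑ s ∈ P.support with ((s 0, s 1) = kk₀ ∧ sX₃ s = m₀),
          ((P.coeff s : ℤ) : ℂ) * (((r : ℝ) : ℂ)) ^ (s 2) := by
      rw [hcoef, Finset.mul_sum]
      push_cast
      refine Finset.sum_congr rfl fun s hs => ?_
      have hs1 : s 2 ≤ D := hJ s (Finset.mem_filter.1 hs).1
      rw [hr_eqC, ← pow_sub_mul_pow (q : ℂ) hs1, div_pow]
      field_simp
    have hfib := fibreSum_ne_zero P (fun s => s 2) (P.support.filter fun s => (s 0, s 1) = kk₀ ∧ sX₃ s = m₀)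
      (Finset.filter_subset _ _)
      (fun s hs s' hs' h => by
        have h1 := (Finset.mem_filter.1 hs).2
        have h2 := (Finset.mem_filter.1 hs').2
        exact eq_of_parts₃ (congrArg Prod.fst (h1.1.trans h2.1.symm)) (congrArg Prod.snd (h1.1.trans h2.1.symm))
          h (h1.2.trans h2.2.symm))
      ⟨s₀, Finset.mem_filter.2 ⟨hs₀, rfl, rfl⟩⟩ r (by rw [← hqdef]; exact hLPq)
    have : (((Cf₂ P p q D kk₀).coeff m₀ : ℤ) : ℂ) = 0 := by rw [h0, coeff_zero, Int.cast_zero]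
    rw [hcast] at this
    exact (mul_ne_zero (pow_ne_zero _ hqC) hfib) this
  -- the norm form N = det M ≠ 0 and its evaluation (g44b verbatim, K = J = D)
  obtain ⟨e⟩ : Nonempty (Fin q × Fin q ≃ Fin (q * q)) := ⟨finProdFinEquiv⟩
  obtain ⟨M, hMdef⟩ : ∃ M : Matrix (Fin (q * q)) (Fin (q * q)) (MvPolynomial (Fin n) ℤ),
      M = Matrix.reindex e e (radMat₂ (Cf₂ P p q D) D p hq i₀ i₁) := ⟨_, rfl⟩
  have hM_apply : ∀ ρ' c', M ρ' c' = radMat₂ (Cf₂ P p q D) D p hq i₀ i₁ (e.symm ρ') (e.symm c') := by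
    intro ρ' c'
    rw [hMdef, Matrix.reindex_apply, Matrix.submatrix_apply]
  obtain ⟨N, hNdef⟩ : ∃ N : MvPolynomial (Fin n) ℤ, N = M.det := ⟨_, rfl⟩
  have hN0 : N ≠ 0 := by
    rw [hNdef, hMdef, Matrix.det_reindex_self]
    exact det_radMat₂_ne_zero i₀ i₁ q hne (Cf₂ P p q D) hq hKq hpq hC
  obtain ⟨f, hfdef⟩ : ∃ f : MvPolynomial (Fin n) ℤ →+* ℂ, f = (MvPolynomial.aeval θ).toRingHom :=
    ⟨_, rfl⟩
  have hf : ∀ Q : MvPolynomial (Fin n) ℤ, f Q = aeval θ Q := fun Q => by rw [hfdef]; rfl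
  obtain ⟨Mθ, hMθ⟩ : ∃ Mθ : Matrix (Fin (q * q)) (Fin (q * q)) ℂ, Mθ = f.mapMatrix M := ⟨_, rfl⟩
  have hMθ_apply : ∀ l a', Mθ l a' = aeval θ (M l a') := fun l a' => by
    rw [hMθ, RingHom.mapMatrix_apply, Matrix.map_apply, hf]
  have hdet : Mθ.det = aeval θ N := by rw [hMθ, ← RingHom.map_det, hf, hNdef]
  set z : Fin (q * q) := e (⟨0, hq⟩, ⟨0, hq⟩) with hz
  have hadj : ∀ a' : Fin (q * q), Mθ.adjugate z a' = aeval θ (M.adjugate z a') := by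
    intro a'
    rw [hMθ, ← RingHom.map_adjugate, RingHom.mapMatrix_apply, Matrix.map_apply, hf]
  -- entry bounds
  obtain ⟨E, hEdef⟩ : ∃ E : ℤ, E = ((D : ℤ) + 1) ^ 2 * (LP * ((p : ℤ) + q) ^ D) := ⟨_, rfl⟩
  have hE1 : 1 ≤ E := by
    have h1 : (1 : ℤ) ≤ ((D : ℤ) + 1) ^ 2 := one_le_pow₀ (by linarith [Int.natCast_nonneg D])
    have h2 : (1 : ℤ) ≤ ((p : ℤ) + q) ^ D :=
      one_le_pow₀ (by linarith [Int.natCast_nonneg p, show (1:ℤ) ≤ q by exact_mod_cast hq])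
    rw [hEdef]
    calc (1 : ℤ) = 1 * (1 * 1) := by ring
      _ ≤ ((D : ℤ) + 1) ^ 2 * (LP * ((p : ℤ) + q) ^ D) :=
          mul_le_mul h1 (mul_le_mul hLP1 h2 zero_le_one (by linarith)) (by norm_num) (by positivity)
  have hentry : ∀ l a', mvlen (M l a') ≤ E := fun l a' => by
    rw [hM_apply, hEdef]
    exact mvlen_radMat₂_le P p q D hq i₀ i₁ (fun kk => mvlen_Cf₂_le P p q D hJ kk)
      (mul_nonneg (mvlen_nonneg P) (pow_nonneg (by positivity) _)) _ _
  have hentry' : ∀ l a', (M l a').totalDegree ≤ δe := fun l a' => by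
    rw [hM_apply]
    exact totalDegree_radMat₂_le P p q D hq i₀ i₁ hpB _ _
  have hNlen : mvlen N ≤ ((q * q).factorial : ℤ) * E ^ (q * q) := by rw [hNdef]; exact mvlen_det_le M hentry
  have hNdeg : N.totalDegree ≤ (q * q) * δe := by rw [hNdef]; exact totalDegree_det_le M hentry'
  have hadjB : ∀ a' : Fin (q * q), mvlen (M.adjugate z a') ≤ ((q * q).factorial : ℤ) * E ^ (q * q) ∧
      (M.adjugate z a').totalDegree ≤ (q * q) * δe := fun a' => adjugate_bounds M hE1 hentry hentry' _ _
  -- (1) the eigen factorisation  det Mθ = Φθ(s,s') · Σ_c adj z c s^a s'^{a'},  Φθ = q^D F(r)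
  have hfact := det_eq_eigen_mul₂ hq D p (fun kk => aeval θ (Cf₂ P p q D kk)) (θ i₀) (θ i₁) s s' hsq hs'q e Mθ
    (by
      intro ρ' c'
      rw [hMθ_apply, hM_apply]
      simp only [radMat₂, map_sum, map_mul, map_pow, aeval_X])
  have heigen : ∑ kk ∈ Finset.range (D + 1) ×ˢ Finset.range (D + 1),
      aeval θ (Cf₂ P p q D kk) * (s ^ (p * kk.1) * s' ^ (p * kk.2)) =
      (q : ℂ) ^ D * Frel₂ P θ y₀ y₁ ((p : ℝ) / q) :=
    eigen_eq_Frel₂ P p q D θ y₀ y₁ hK hJ hq s s' hsp hs'p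
  -- the eigenvalue bound ‖Φ‖ ≤ q^D · (Kl · X)
  have hFσX : ‖Frel₂ P θ y₀ y₁ σ‖ < X := hsmallF
  have hdistle : X ≤ Real.exp (-Real.exp (((q : ℝ) ^ 2) ^ (A + 1))) := le_of_eq (by rw [hX])
  have hΦ : ‖∑ kk ∈ Finset.range (D + 1) ×ˢ Finset.range (D + 1),
      aeval θ (Cf₂ P p q D kk) * (s ^ (p * kk.1) * s' ^ (p * kk.2))‖ ≤ (q : ℝ) ^ D * (Kl * X) := by
    rw [heigen, norm_mul, norm_pow, Complex.norm_natCast]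
    refine mul_le_mul_of_nonneg_left ?_ (by positivity)
    have hLip := lipschitz_Frel₂_explicit P hΘ1 hθΘ y₀ y₁ σ (x := (p : ℝ) / q) (by rw [← hr_eq]; exact hρr1)
    rw [← hr_eq] at hLip
    have h1 : ‖Frel₂ P θ y₀ y₁ (r : ℝ)‖ ≤ Klx * |(r : ℝ) - σ| + ‖Frel₂ P θ y₀ y₁ σ‖ := by
      have := norm_add_le (Frel₂ P θ y₀ y₁ (r : ℝ) - Frel₂ P θ y₀ y₁ σ) (Frel₂ P θ y₀ y₁ σ)
      rw [sub_add_cancel] at this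
      exact this.trans (by rw [hKlx]; linarith [hLip])
    rw [hr_eq] at h1
    rw [hr_eq] at hrX
    calc ‖Frel₂ P θ y₀ y₁ ((p : ℝ) / q)‖ ≤ Klx * |(p : ℝ) / q - σ| + ‖Frel₂ P θ y₀ y₁ σ‖ := h1
      _ ≤ Klx * X + X := add_le_add (mul_le_mul_of_nonneg_left hrX hKlx0) hFσX.le
      _ = Kl * X := by rw [hKl]; ring
  -- the eigenvector coordinates are bounded by Θ^q·Θ^q
  have hw : ∀ a' : Fin (q * q), ‖s ^ ((e.symm a').1 : ℕ) * s' ^ ((e.symm a').2 : ℕ)‖ ≤ Θ ^ q * Θ ^ q := by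
    intro a'
    rw [norm_mul, norm_pow, norm_pow]
    exact mul_le_mul
      ((pow_le_pow_left₀ (norm_nonneg _) hsΘ _).trans (pow_le_pow_right₀ hΘ1 (e.symm a').1.isLt.le))
      ((pow_le_pow_left₀ (norm_nonneg _) hs'Θ _).trans (pow_le_pow_right₀ hΘ1 (e.symm a').2.isLt.le))
      (by positivity) (by positivity)
  -- steps (2)–(5): the tree's clash engine, at Q₁ := q
  exact twoRadical_clash hq hA₀ hN0 hdet hadj hE1 hNlen hNdeg hadjB hΘ1 hθΘ hw hfact hKl0 hX0 hΦ hA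
    hdistle hLP1 hpB hEdef hcE hcN hcU hc₃ ha hQ₁ hqqN

end Quantitative

end Summit.Schanuel.Schanuel.Theorems.RootDecomp1BProductCell

end
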